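import Literature.AlgebraicGeometry.Resolution.CentreBlowupAdaptedOrder
import Literature.AlgebraicGeometry.Resolution.CentreBlowupRemark32
import HarnessLib

/-!
# Clause (iii) of [Cossart–Piltant 2019, Def. 3.2] with the boundary monomial `H_W` divided out

`CentreBlowupAdaptedOrder.HasTransverseLinear S s` types clause (iii) of [CP19, Def. 3.2],
"`J̄(F_{p,Z,W},E,W) := cl₀ J(F_{p,Z,W},E,W) ≠ 0`", in the shape of Prop. 3.3 — "some monomial of `F` of
least `S`-degree is of degree exactly one in exactly one variable `t` off `S`, and `t ∉ exc`" — which is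
the atlas column `cp_iii` under the walk rules `bm` / `bm′`, where every centre CONTAINS the boundary
(`exc ⊆ S`).  In [CP19] the module `J(F,E,W) := H_W⁻¹ 𝒥(F,E,W)` is taken AFTER dividing by the monomial

  "`H_W := (∏_{j∈J_E} U_j^{H_j} ∏_{j'∈(J')_E} ū_{j'}^{H_{j'}})`"   ((3.1), p. 31; `(J')_E` = the components
  of `E` NOT containing `W`),

and Prop. 3.3 expands `H⁻¹F_{p,Z} = <Σ_{j'∈J'} U_{j'}Φ_{j'}({U_j}_{j∈J}) + Ψ({U_j}_{j∈J})>`, "with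
`Φ_{j'} ≠ 0` for some `j' ∈ J' ∖ (J')_E`"; its proof records
"`J̄(F_{p,Z,W},E,W) = <cl₀(H_W⁻¹ ∂F_{p,Z,W}/∂ū_{j'}), j' ∈ J' ∖ (J')_E>`".
Read in the monomial model WITHOUT assuming `exc ⊆ S`, the division by `ū_{j'}^{H_{j'}}` for the boundary
variables `j' ∈ exc ∖ S` matters: `cl₀(H_W⁻¹ ∂F_{p,Z,W}/∂ū_t) ≠ 0` asks for a monomial `y^d` of `F` of
least `S`-degree whose part off `S` is EXACTLY `y_t · ∏_{u ∈ exc ∖ S} y_u^{H_u}` (`t ∉ S`, `t ∉ exc`) —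
i.e. `d_t = 1`, `d_u = 0` for the other non-boundary `u ∉ S`, and `d_u = H_u` (the minimal exponent
`bigH F u`, not `0`) for the boundary `u ∈ exc ∖ S`.  This file types that reading,
`HasTransverseLinearH`, and PROVES:

* `hasTransverseLinearH_iff_of_bigH_eq_zero`: the two readings agree whenever `H_u = 0` for every
  `u ∈ exc ∖ S` — in particular whenever `exc ⊆ S` (`…_of_exc_subset`: the atlas rules `bm`, `bm′`), so
  the census column `cp_iii` IS clause (iii) on the atlas' domain; likewise `IsSecondKindH ↔ IsSecondKind`;
* `not_hasTransverseLinear_of_bigH_ne_zero`: off that domain the undivided reading is blind — if some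
  boundary variable `u ∉ S` divides `F` (`H_u ≠ 0`), `HasTransverseLinear S s` is false whatever `F` is,
  while `HasTransverseLinearH` divides `y_u^{H_u}` out first, as (3.1) prescribes;
* the published states: for [CP19, Rem. 3.2] (`cp19Remark32`, `E = div(u₁u₂u₃)`) the off-centre boundary
  variable `u₃` has `H_{u₃} = 0` at both centres `𝒴₁ = V(Z,u₁,u₂,u₄)` and `𝒴₀ = V(Z,u₁,u₂)`, so both
  readings agree there: (iii) fails at `𝒴₁` and holds at `𝒴₀` in either reading (`CentreBlowupRemark32`).

Scope: case `G = 0` (`i₀ = p`), constant coefficients (no derivations of `k(x)`), the state's own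
coordinates; under (ii) of Def. 3.2 the non-lowering derivations `U_j∂_{U_j}`, `∂_{U_j}`, `ū_{j'}∂_{ū_{j'}}`
of `𝒟_W` contribute nothing to `cl₀` (Prop. 3.3, proof), which is why only the `∂/∂ū_t`, `t` non-boundary,
appear.  Definitions and their unfolding / comparison lemmas only; nothing about resolution is asserted.
AI-assisted formalisation (observatory `pub-rosobs`, unit `pub-rosobs-carver-g25`); quotations from
arXiv:1412.0868 (PDF pages 31–32).
-/

noncomputable section

open MvPolynomial Finset

open scoped BigOperators

namespace Literature.AlgebraicGeometry.Resolution

open Literature.AlgebraicGeometry.Resolution.Hauser2010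

namespace CentreBlowup

variable {σ : Type*} {K : Type*}

section Defs

variable [CommRing K]

/-- **Clause (iii) of Def. 3.2 with `H_W` divided out**: "`J̄(F_{p,Z,W},E,W) := cl₀ J(F_{p,Z,W},E,W) ≠ 0`",
`J(F,E,W) := H_W⁻¹𝒥(F,E,W)`, "`H_W := (∏_{j∈J_E} U_j^{H_j} ∏_{j'∈(J')_E} ū_{j'}^{H_{j'}})`",
"`J̄(F_{p,Z,W},E,W) = <cl₀(H_W⁻¹ ∂F_{p,Z,W}/∂ū_{j'}), j' ∈ J' ∖ (J')_E>`" — model reading: some monomial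
`y^d` of `F` of least `S`-degree has, off `S`, exactly the shape `y_t · ∏_{u ∈ exc, u ∉ S} y_u^{H_u}` with
`t ∉ S`, `t ∉ exc`: `d_t = 1`; `d_u = 0` for `u ∉ S ∪ exc`, `u ≠ t`; `d_u = H_u` for `u ∈ exc`, `u ∉ S`.
[cite: CossartPiltant2019, Def. 3.2 (iii) (p. 32) with (3.1) (p. 31) and Prop. 3.3 (p. 32)] -/
def HasTransverseLinearH (S : Finset σ) (s : CState σ K) : Prop :=
  ∃ d ∈ s.F.support, (degIn S d : ℕ∞) = ordAlong S s.F ∧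
    ∃ t, t ∉ S ∧ t ∉ s.exc ∧ d t = 1 ∧
      ∀ u, u ∉ S → u ≠ t →
        (u ∉ s.exc → d u = 0) ∧ (u ∈ s.exc → ((d u : ℕ) : ℕ∞) = PointBlowup.bigH s.F u)

/-- **Permissible of the second kind**, clause (iii) read with `H_W` divided out:
"(i) `𝒴` is Hironaka-permissible w.r.t. `E` at `x`; (ii) `ε(y) = ε(x) − 1` and `i₀(y) ≤ i₀(x)`;
(iii) `J̄(F_{p,Z,W},E,W) ≠ 0`". [cite: CossartPiltant2019, Def. 3.2 (p. 32)] -/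
def IsSecondKindH [DecidableEq σ] (q : ℕ) (S : Finset σ) (s : CState σ K) : Prop :=
  IsHironakaPermissible q S s ∧ epsilonAlong S s + 1 = s.epsilon ∧ HasTransverseLinearH S s

/-! ### The two readings agree when no boundary variable off `S` divides `F` -/

/-- If `H_u = 0` for every boundary variable `u ∉ S` (no `ū_{j'}`, `j' ∈ (J')_E`, divides `F_{p,Z,W}`),
then `H_W` has no factor off `S` and the divided and undivided readings of (iii) coincide.
[cite: CossartPiltant2019, Def. 3.2 (iii) (p. 32) with (3.1) (p. 31)] -/
theorem hasTransverseLinearH_iff_of_bigH_eq_zero (S : Finset σ) (s : CState σ K)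
    (h : ∀ u ∈ s.exc, u ∉ S → PointBlowup.bigH s.F u = 0) :
    HasTransverseLinearH S s ↔ HasTransverseLinear S s := by
  constructor
  · rintro ⟨d, hd, hdeg, t, htS, htE, hdt, hrest⟩
    refine ⟨d, hd, hdeg, t, htS, htE, hdt, fun u huS hut => ?_⟩
    by_cases hu : u ∈ s.exc
    · have h1 := (hrest u huS hut).2 hu
      rw [h u hu huS, ← ENat.coe_zero, ENat.coe_inj] at h1
      exact h1
    · exact (hrest u huS hut).1 hu
  · rintro ⟨d, hd, hdeg, t, htS, htE, hdt, hrest⟩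
    refine ⟨d, hd, hdeg, t, htS, htE, hdt, fun u huS hut => ⟨fun _ => hrest u huS hut, fun hu => ?_⟩⟩
    rw [h u hu huS, hrest u huS hut, Nat.cast_zero]

/-- On the atlas' domain (`exc ⊆ S`: every admissible centre of the rules `bm`, `bm′` contains the
boundary, so `(J')_E = ∅`) the census column `cp_iii` (`HasTransverseLinear`) is clause (iii).
[cite: CossartPiltant2019, Def. 3.2 (iii) (p. 32) with (3.1) (p. 31)] -/
theorem hasTransverseLinearH_iff_of_exc_subset (S : Finset σ) (s : CState σ K) (h : s.exc ⊆ S) :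
    HasTransverseLinearH S s ↔ HasTransverseLinear S s :=
  hasTransverseLinearH_iff_of_bigH_eq_zero S s fun _ hu huS => (huS (h hu)).elim

/-- The same for the full Def. 3.2. [cite: CossartPiltant2019, Def. 3.2 (p. 32)] -/
theorem isSecondKindH_iff_of_bigH_eq_zero [DecidableEq σ] (q : ℕ) (S : Finset σ) (s : CState σ K)
    (h : ∀ u ∈ s.exc, u ∉ S → PointBlowup.bigH s.F u = 0) :
    IsSecondKindH q S s ↔ IsSecondKind q S s := by
  unfold IsSecondKindH IsSecondKind
  rw [hasTransverseLinearH_iff_of_bigH_eq_zero S s h]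

/-- The same for the full Def. 3.2 on the atlas' domain `exc ⊆ S`. [cite: CossartPiltant2019, Def. 3.2 (p. 32)] -/
theorem isSecondKindH_iff_of_exc_subset [DecidableEq σ] (q : ℕ) (S : Finset σ) (s : CState σ K)
    (h : s.exc ⊆ S) : IsSecondKindH q S s ↔ IsSecondKind q S s :=
  isSecondKindH_iff_of_bigH_eq_zero q S s fun _ hu huS => (huS (h hu)).elim

/-! ### Off that domain the undivided reading is blind -/

/-- If a boundary variable `u ∉ S` divides `F` (`H_u ≠ 0`), the undivided reading of (iii) fails
regardless of `F`: every monomial has `d_u ≥ H_u > 0`, whereas (3.1) divides `ū_u^{H_u}` out first.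
[cite: CossartPiltant2019, (3.1) (p. 31)] -/
theorem not_hasTransverseLinear_of_bigH_ne_zero (S : Finset σ) (s : CState σ K) {u : σ}
    (hu : u ∈ s.exc) (huS : u ∉ S) (hH : PointBlowup.bigH s.F u ≠ 0) : ¬ HasTransverseLinear S s := by
  rintro ⟨d, hd, -, t, -, htE, -, hrest⟩
  have hut : u ≠ t := fun h => htE (h ▸ hu)
  have hle : PointBlowup.bigH s.F u ≤ ((d u : ℕ) : ℕ∞) :=
    Finset.inf_le (f := fun d : σ →₀ ℕ => ((d u : ℕ) : ℕ∞)) hd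
  rw [hrest u huS hut, Nat.cast_zero, nonpos_iff_eq_zero] at hle
  exact hH hle

/-- … while the divided reading only asks `d_u = H_u` there: its clause at such a `u` holds for every
monomial attaining the minimal exponent. [cite: CossartPiltant2019, (3.1) (p. 31)] -/
theorem bigH_le_apply_of_mem_support (s : CState σ K) {d : σ →₀ ℕ} (hd : d ∈ s.F.support) (u : σ) :
    PointBlowup.bigH s.F u ≤ ((d u : ℕ) : ℕ∞) :=
  Finset.inf_le (f := fun d : σ →₀ ℕ => ((d u : ℕ) : ℕ∞)) hd

end Defs

/-! ### The published states of [CP19, Rem. 3.2]: the two readings agree -/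

section Remark32

variable [Field K]

/-- [CP19, Rem. 3.2], centre `𝒴₁ = V(Z,u₁,u₂,u₄)`: the boundary variable `u₃` lies off the centre but
`H_{u₃} = 0`, so the readings agree, and (iii) fails in the divided reading too ("Note that `𝒴₁` does not
satisfy definition 3.2 (iii)": every variable off `𝒴₁` is a boundary variable). [cite: CossartPiltant2019, Remark 3.2 (p. 41)] -/
theorem cp19Remark32_not_hasTransverseLinearH_centre (p : ℕ) :
    ¬ HasTransverseLinearH cp19Remark32Centre (cp19Remark32 p : CState (Fin 4) K) := by
  rw [hasTransverseLinearH_iff_of_bigH_eq_zero _ _ fun u _ _ => cp19Remark32_bigH p u]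
  exact cp19Remark32_not_hasTransverseLinear_centre p

/-- [CP19, Rem. 3.2], centre `𝒴₁`: not permissible of the second kind in the divided reading either.
[cite: CossartPiltant2019, Remark 3.2 (p. 41)] -/
theorem cp19Remark32_not_isSecondKindH_centre (p : ℕ) :
    ¬ IsSecondKindH p cp19Remark32Centre (cp19Remark32 p : CState (Fin 4) K) :=
  fun h => cp19Remark32_not_hasTransverseLinearH_centre p h.2.2

/-- [CP19, Rem. 3.2], the curve `𝒴₀ = V(Z,u₁,u₂)` ("permissible of the second kind at `x`"): second kind
in the divided reading as well (`H_{u₃} = 0`; `u₄` is not a boundary variable). [cite: CossartPiltant2019, Remark 3.2 (p. 41)] -/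
theorem cp19Remark32_isSecondKindH_curve (p : ℕ) :
    IsSecondKindH p cp19Remark32Curve (cp19Remark32 p : CState (Fin 4) K) := by
  rw [isSecondKindH_iff_of_bigH_eq_zero _ _ _ fun u _ _ => cp19Remark32_bigH p u]
  exact cp19Remark32_isSecondKind_curve p

end Remark32

end CentreBlowup

end Literature.AlgebraicGeometry.Resolution

end
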